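import Literature.NumberTheory.EllipticCurves.Kato2004.IwasawaH2FineSelmerDualCount
import HarnessLib

/-!
# Kato 2004 (Astérisque 295): `𝐇²_Γ(T_pW) ⊇ X₀(E/ℚ_∞)` with finite cokernel, `(𝐇²_Γ)_Γ` FINITE IFF `Sel_str(ℚ, W[p^∞])`
# FINITE, and then `#(𝐇²_Γ)_Γ · #W(ℚ)[p^∞] = #Sel_str · #W(ℚ_p)[p^∞]` — with NO RANK GUARD ((14.14.2) + (14.9.3)) — ONE named
# fact "H2Xʳ" (GUARDED typing: no `Nat.card` is asserted on a possibly infinite type), the rank-free sequel of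
# `exists_iwasawaH2Data_fineSelmerDual_embedding_count` (H2X⁺), and its proved corollaries (H2Xʳ → H2X; H2Xʳ → H2X⁺ modulo the
# elementary finiteness of `Sel_str` in rank `0`; the count given `(𝐇²_Γ)_Γ` finite; H2Xʳ ⟹ the unguarded `Nat.card` identity)

Topic `NumberTheory/EllipticCurves`, sub-directory `Kato2004` (namespace = path). ONE `def … : Prop` (named fact,
review-queued, net debt +1), theorems otherwise; no instance, no notation, no `sorry`. Typed by planner `bsd-idea-9`
(g40, ideator on crux stmt-BirchSwinnertonDyer-19715 `ErratumRoadFive.EulerHalfNotRamNoInertSetAtFive`, line `kato_Fframe`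
r5.2, stub S1Λ `stub_katoLambdaLogBoundTamagawa`), in the shared `Kato2004/` namespace next to H2X (cell `bsd-cm`,
`IwasawaH2FineSelmerDualComparison.lean`) and H2X⁺ (cell `bsd-potss`, `IwasawaH2FineSelmerDualCount.lean`); Literature is
append-only, so the sharpening is a NEW module importing H2X⁺'s. GUARDED TYPING at the route pen's request (cell
`bsd-stepL`, 2026-08-30: "never lean on `Nat.card` junk in a named fact"): the count clause carries the guard
`Finite Sel_str →`, and the printed inclusion `Sel_str^∨ ↪ H²(ℤ[1/p],T) ≅ (𝐇²_Γ)_Γ` is typed separately as the finiteness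
EQUIVALENCE `Finite Sel_str ↔ Finite (𝐇²_Γ)_Γ`; the unguarded `Nat.card` identity of the first typing (same decl name,
staged 39b518ca7c221ba9, never proposed) is then a proved COROLLARY (`….natCard_eq`), so every consumer of either typing
is served. HONEST FRAMING: BSD is not advanced by this file; nothing about Kato's Main Conjecture is asserted; the fact is a
CONSTRUCTION fact about Kato's genuine `𝐇²_Γ(T_pW)` (as H2X, H2X⁺ and `nonempty_iwasawaH2Data` are), never stronger than
print.

## Why a sequel of H2X⁺ (what changes: the guard of the count clause, and the finiteness equivalence)

H2X⁺ asserts, inside H2X's existential, the COUNT `KatoH2CountAt W p #(J.H2)_Γ` — Kato's (14.14.2) `𝐇²(T)/𝔞𝐇²(T) ≅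
H²(ℤ[1/p], T)` followed by the order of `H²(ℤ[1/p], T_pW)` read off the Poitou–Tate sequence (14.9.3) — under the guard
«`W(ℚ)` finite and `Ш(W)[p^∞]` finite». That guard restricts the clause to RANK ZERO, whereas BOTH rank-one consumers in
the tree need the same printed count in rank one:
* cell `bsd-stepL`, crux 19715, stub S1Λ: the level-0 control count `#(J.H2)_Γ = #Sel_str · #W(ℚ_p)[p^∞]` (with
  `W(ℚ)[p] = 0`) that turns the divisibility `#(J.H2)_Γ ∣ [H¹(ℤ[1/p],T_pW) : ℤ_p·s₀]` (Theorems
  `ErratumRoadFiveKatoFframeH2CoinvariantsIndex`, from Kato Thm. 12.5 (4) via `AdmissibleZetaClassLengthInequality`, which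
  also gives `(J.H2)_Γ` FINITE) into a bound on `#Ш[p^∞] · Tam(W)`;
* cell `bsd-cm`, cruxes 19945 / 19223, display COUNT-H2 (`Rank1Residual/Additive/KatoDescentRankOneCountOfH2Count.lean` §3,
  whose docstring records that H2X⁺ "speaks only in rank 0").
The printed derivation needs NO rank hypothesis. In (14.9.3) (p. 240, "exact in the case `p ≠ 2`")
  `0 → H¹(ℤ[1/p],T)/H¹_f → H¹(ℚ_p,T)/H¹_f →ᵇ S(ℚ,T*(1))^∨ →ᶜ H²(ℤ[1/p],T) → H²(ℚ_p,T) → H⁰(ℤ[1/p],T*(1)⊗ℚ/ℤ)^∨ → 0`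
(`T = T_pW`, `T*(1) ⊗ ℚ_p/ℤ_p ≅ W[p^∞]` by the Weil pairing; `H^q(ℤ[1/p], ·) = H^q_ét(Spec ℤ[1/p], j_* ·)`, 8.2 (p. 180);
`S(ℚ, ·)` = Kato's Selmer group of 14.8: unramified outside `p`, `H¹_f` at `p`) one has: `coker b ≅ (ker loc_p|_S)^∨ =
Sel_str^∨` with `Sel_str` = the classes unramified off `p` and trivial at `p` = the tree's `katoStrictSelmer W p {v_p}`
(`b` is Pontryagin dual to `loc_p : S → H¹_f(ℚ_p, W[p^∞]) ≅ (H¹(ℚ_p,T)/H¹_f)^∨`, local Tate duality + [BK2] §3, p. 239);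
`H²(ℚ_p, T) ≅ H⁰(ℚ_p, W[p^∞])^∨ = W(ℚ_p)[p^∞]^∨` (local duality), FINITE; `H⁰(ℤ[1/p], W[p^∞]) = W(ℚ)[p^∞]`, FINITE, and the
last map is surjective. Hence (i) `Sel_str^∨ ↪ H²(ℤ[1/p],T)` with cokernel inside the finite `W(ℚ_p)[p^∞]^∨`, so
`H²(ℤ[1/p],T) ≅ (𝐇²_Γ)_Γ` ((14.14.2)) is FINITE IFF `Sel_str` is; and (ii) when they are finite,
`#(𝐇²_Γ)_Γ · #W(ℚ)[p^∞] = #Sel_str · #W(ℚ_p)[p^∞]` as natural numbers. Clauses (i) and (ii) are what this file's H2Xʳ adds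
to H2X's embedding clause, for THE `J ⊇ X₀`. The rank-one consumer gets `(J.H2)_Γ` finite from (14.14.1), then `Sel_str`
finite from (i), then the count from (ii) (corollary `exists_count_of_finite_coinvariants`).

## SCOPE of the fact (exactly H2X's)

* `p ≠ 2`; `κ` CYCLOTOMIC with topological generator `γ`; `W(ℚ_{p,∞})[p^∞]` FINITE (the fixed points of
  `ker κ ⊓ D_v` on `W(ℚ̄)[p^∞]`, `v` the place at `p`) — HOLDS at every potentially good `p` (Imai 1975, tree
  `IwasawaTowerTorsionPotGoodLocal`), at good ordinary / potentially ordinary `p` (tree theorems) and at multiplicative odd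
  `p` (Tate uniformisation; being landed under `Summits/…/Theorems` by the consumer cell), FAILS for `p` odd exactly at
  Kato's (12.5.1); nothing is said there, at `p = 2`, or for non-cyclotomic `κ`.
* NO rank guard, NO `Ш` guard; NO `Nat.card` of a possibly infinite type inside an asserted identity (the count is guarded
  by `Finite Sel_str`, and under that guard all four groups are finite by clause (i) and the finiteness of `W(ℚ)[p^∞]`,
  `W(ℚ_p)[p^∞]`).
WEAKER than print (the maps to `𝐇²_{Γ,loc}`, the isomorphism (14.14.2) itself and the identity of `H2` are forgotten;
only "injective with finite cokernel", the finiteness equivalence and the COUNT are kept), never stronger. H2X⁺'s guarded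
clause follows from H2Xʳ together with the ELEMENTARY finiteness «`W(ℚ)` finite ∧ `Ш[p^∞]` finite ⇒ `Sel_str` finite»
(`Sel_str ⊆ Sel_{p^∞}(W/ℚ)`, Kummer sequence), which is not a theorem of the Literature library at this import level and
is therefore an explicit hypothesis of the corollary `….count` (not part of the fact). JUNK AUDIT: not vacuous (the
manufactured package of `IwasawaH2DataOfInjectivityProofs` has `#(H2)_Γ = #A/ι(𝐇¹_Γ/T)`, not the strict Selmer count in
general; a `J` padded by a finite `Λ`-module with trivial `T`-action keeps H2X's clause and breaks the count; a `J` padded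
by `Λ/(T)` breaks clause (i)); not refutable by cooked data (an `∃` over `J`); consistent with H2X (corollary `embedding`)
and with H2X⁺ (corollary `count`). `KatoH2CountAt` reads `W(ℚ_p)` as Mathlib's points of `W ⊗ ℚ_v`,
`ℚ_v = (primePlace p).adicCompletion ℚ` (conventions of `StrictSelmerH2Count.lean`).

## References

* K. Kato, Astérisque 295 (2004): 8.2 (p. 180: `H^q(R, ·) := H^q(R, j_* ·)`), 12.2 (12.2.1)–(12.2.3) (p. 220), Thm. 12.4 (1)
  (p. 221), (12.5.1) and Rem. 12.7 (p. 222), 13.8 (p. 228), §14.1 (p. 235), 14.8 (pp. 238–239: `S(K,T)`), (14.9.1) (p. 239),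
  (14.9.3) (p. 240), §14.14 (14.14.1)–(14.14.2) (p. 243), proof of Prop. 14.16 (2) (p. 245), (17.13.1) (p. 279) — store key
  `paper:doi-10-24033-ast-639` (PDF page = printed page − 115), pp. 180, 239, 240, 243 re-read by this seat. [Kato2004Asterisque]
* J. S. Milne, *Arithmetic Duality Theorems* (2006), I Cor. 2.3 (local duality), Thm. 4.10 (Poitou–Tate). [MilneADT2006]
* S. Bloch, K. Kato, in *The Grothendieck Festschrift* I (1990), §3 (Def. 3.10, Ex. 3.11, Prop. 3.8: `H¹_f` and its
  orthogonality under local duality). [BlochKato1990]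
* Tree: `Kato2004/IwasawaH2FineSelmerDualCount.lean` (H2X⁺, the fact this file sharpens, and its corollaries),
  `Kato2004/IwasawaH2FineSelmerDualComparison.lean` (H2X), `Kato2004/IwasawaH2Descent.lean` (`IwasawaH2Data`),
  `Kato2004/StrictSelmerH2Count.lean` (`katoStrictSelmer`, `KatoH2CountAt`, `katoH2CountAt_iff`),
  `KatoFineSelmerDualProofs.lean` (`WeierstrassCurve.fineSelmerDualData`), `Sha.lean` (`WeierstrassCurve.sha`); consumers
  `Summits/BirchSwinnertonDyer/BirchSwinnertonDyer/Theorems/ErratumRoadFiveKatoFframeH2CoinvariantsIndex.lean`,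
  `Summits/BirchSwinnertonDyer/Rank1Residual/Additive/KatoDescentRankOneCountOfH2Count.lean`.
-/

noncomputable section

open scoped Classical NumberField
open Field IsDedekindDomain
open Literature.NumberTheory.GaloisRepresentations
open Literature.NumberTheory.EllipticCurves Literature.NumberTheory.EllipticCurves.IwasawaAlgebra
open Literature.NumberTheory.EllipticCurves.Module

namespace Literature.NumberTheory.EllipticCurves.Kato2004

/-! ## The named fact -/

/-- **Kato's `𝐇²_Γ(T_pW)` contains `X₀(E/ℚ_∞)` with finite cokernel; its coinvariants `(𝐇²_Γ)_Γ ≅ H²(ℤ[1/p],T_pW)` are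
finite IFF the strict Selmer group `Sel_str(ℚ, W[p^∞])` is finite; and in that case
`#(𝐇²_Γ)_Γ · #W(ℚ)[p^∞] = #Sel_str · #W(ℚ_p)[p^∞]` — with NO rank guard (`p` odd, `W(ℚ_{p,∞})[p^∞]` finite).** For an
elliptic curve `W/ℚ`, an odd prime `p`, the CYCLOTOMIC `ℤ_p`-extension `κ` with topological generator `γ`, the place `v`
of `ℚ` at `p`, under the hypothesis that `W(ℚ_{p,∞})[p^∞] = (W(ℚ̄)[p^∞])^{ker κ ⊓ D_v}` is finite, and for every pinned
Iwasawa cohomology `I : IwasawaH1Data W p κ γ`: there is a descent package `J : IwasawaH2Data W p κ γ I` (Kato's `𝐇²_Γ(T_pW)`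
with (12.2.1), Thm. 12.4 (1), (14.14.1) pinned to `proj₀`) TOGETHER WITH an injective `Λ`-linear map
`X₀(E/ℚ_∞) = (W.fineSelmerDualData κ hγ).X → J.H2` of finite cokernel ((14.9.1) in the limit (17.13.1)) — VERBATIM the text
of `exists_iwasawaH2Data_fineSelmerDual_embedding` (H2X) — AND: (i) `(J.H2)_Γ = J.H2/T·J.H2` is finite iff
`katoStrictSelmer W p {v_p}` is finite (the printed exact `Sel_str^∨ ↪ H²(ℤ[1/p],T) → H²(ℚ_p,T) ≅ W(ℚ_p)[p^∞]^∨`, (14.9.3),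
with (14.14.2)); (ii) if `katoStrictSelmer W p {v_p}` is finite, the COUNT `KatoH2CountAt W p #(J.H2)_Γ`, i.e.
`#(J.H2/T·J.H2) · #W(ℚ)[p^∞] = #katoStrictSelmer W p {v_p} · #W(ℚ_p)[p^∞]` ((14.14.2) and the orders in (14.9.3):
`coker b = Sel_str^∨`, `H²(ℚ_p,T) ≅ W(ℚ_p)[p^∞]^∨`, `H⁰(ℤ[1/p], W[p^∞]) = W(ℚ)[p^∞]`). Compared with H2X⁺
(`exists_iwasawaH2Data_fineSelmerDual_embedding_count`) the guard «`W(ℚ)` finite, `Ш(W)[p^∞]` finite» of the count clause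
is REPLACED by «`Sel_str` finite» (which it implies, elementary) and the finiteness equivalence (i) is added; no `Nat.card`
of a possibly infinite type is asserted. A CONSTRUCTION fact (review-queued); SCOPE and conventions: module docstring.
Nothing is asserted at `p = 2`, for non-cyclotomic `κ`, or when `W(ℚ_{p,∞})[p^∞]` is infinite (Kato (12.5.1)).
[cite: Kato2004Asterisque, 8.2 (p. 180), 14.8 (pp. 238–239), (14.9.1) (p. 239), (14.9.3) (p. 240), §14.14 (14.14.1)–(14.14.2) (p. 243), 12.2 (12.2.1)–(12.2.3) (p. 220), Thm. 12.4 (1) (p. 221), 13.8 (p. 228), proof of Prop. 14.16 (2) (p. 245), (17.13.1) (p. 279)]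
[cite: MilneADT2006, Ch. I, Cor. 2.3 and Thm. 4.10] [cite: BlochKato1990, §3, Prop. 3.8] -/
def exists_iwasawaH2Data_fineSelmerDual_embedding_countRankFree : Prop :=
  ∀ (W : WeierstrassCurve ℚ) [W.IsElliptic] (p : ℕ) [Fact p.Prime] [ContinuousSMul ℤ_[p] (W.tateModule p)]
    (κ : ZpExtension ℚ p) (γ : absoluteGaloisGroup ℚ) (hγ : κ.IsTopGenerator γ)
    (v : HeightOneSpectrum (𝓞 ℚ)),
    p ≠ 2 → κ.IsCyclotomic → ((Rat.HeightOneSpectrum.primesEquiv v : Nat.Primes) : ℕ) = p →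
    Finite (FixedPoints.addSubgroup ↥(κ.kerSubgroup ⊓ GreenbergSelmer.decomp v) (W.geomPrimaryTorsion p)) →
    ∀ I : IwasawaH1Data W p κ γ,
      ∃ (J : IwasawaH2Data W p κ γ I) (e : (W.fineSelmerDualData κ hγ).X →ₗ[IwasawaAlgebra p] J.H2),
        Function.Injective e ∧ Finite (J.H2 ⧸ LinearMap.range e) ∧
          (Finite (katoStrictSelmer W p {primePlace p}) ↔ Finite (coinvariants p J.H2)) ∧
          (Finite (katoStrictSelmer W p {primePlace p}) → KatoH2CountAt W p (Nat.card (coinvariants p J.H2)))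

/-! ## Proved corollaries (the consumer shapes) -/

section Corollaries

variable {W : WeierstrassCurve ℚ} [W.IsElliptic] {p : ℕ} [Fact p.Prime] [ContinuousSMul ℤ_[p] (W.tateModule p)]
  {κ : ZpExtension ℚ p} {γ : absoluteGaloisGroup ℚ}

/-- **H2Xʳ ⟹ H2X**: dropping clauses (i), (ii) gives `exists_iwasawaH2Data_fineSelmerDual_embedding` verbatim.
[cite: Kato2004Asterisque, (14.9.1) (p. 239), (14.14.1) (p. 243)] -/
theorem exists_iwasawaH2Data_fineSelmerDual_embedding_countRankFree.embedding
    (h : exists_iwasawaH2Data_fineSelmerDual_embedding_countRankFree) :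
    exists_iwasawaH2Data_fineSelmerDual_embedding := by
  intro W _ p _ _ κ γ hγ v hp hκ hv hfin I
  obtain ⟨J, e, he, hcok, -, -⟩ := h W p κ γ hγ v hp hκ hv hfin I
  exact ⟨J, e, he, hcok⟩

/-- **H2Xʳ ⟹ H2X⁺ modulo the elementary finiteness of `Sel_str` in rank `0`**: given «`W(ℚ)` finite ∧ `Ш(W)[p^∞]`
finite ⇒ `katoStrictSelmer W p {v_p}` finite» (`Sel_str ⊆ Sel_{p^∞}(W/ℚ)`, an extension of `Ш[p^∞]` by
`W(ℚ) ⊗ ℚ_p/ℤ_p = 0`; elementary, supplied by the caller — it is not a theorem of this library at this import level),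
H2Xʳ gives `exists_iwasawaH2Data_fineSelmerDual_embedding_count` verbatim.
[cite: Kato2004Asterisque, (14.9.3) (p. 240), (14.14.2) (p. 243)] [cite: SilvermanAEC2009, X.4 Thm. 4.2 (the Kummer sequence)] -/
theorem exists_iwasawaH2Data_fineSelmerDual_embedding_countRankFree.count
    (h : exists_iwasawaH2Data_fineSelmerDual_embedding_countRankFree)
    (hfinSel : ∀ (W : WeierstrassCurve ℚ) [W.IsElliptic] (p : ℕ) [Fact p.Prime],
      Finite W.toAffine.Point → Finite (AddCommGroup.primaryComponent W.sha p) →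
        Finite (katoStrictSelmer W p {primePlace p})) :
    exists_iwasawaH2Data_fineSelmerDual_embedding_count := by
  intro W _ p _ _ κ γ hγ v hp hκ hv hfin I
  obtain ⟨J, e, he, hcok, -, hc⟩ := h W p κ γ hγ v hp hκ hv hfin I
  exact ⟨J, e, he, hcok, fun hW hsha ↦ hc (hfinSel W p hW hsha)⟩

/-- **The count per pin, in ANY rank, from the finiteness of `(J.H2)_Γ`** (`p` odd, `κ` cyclotomic, `W(ℚ_{p,∞})[p^∞]`
finite): some `J ⊇ X₀` of finite cokernel has: if `(J.H2)_Γ` is finite (e.g. by (14.14.1) in rank one: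
`#(J.H2)_Γ ∣ [H¹(ℤ[1/p],T) : ℤ_p s₀]`), then `Sel_str` is finite and `#(J.H2)_Γ · #W(ℚ)[p^∞] = #Sel_str · #W(ℚ_p)[p^∞]`.
This is the shape the rank-one S1Λ consumer uses. [cite: Kato2004Asterisque, (14.9.3) (p. 240), (14.14.1)–(14.14.2) (p. 243)] -/
theorem exists_iwasawaH2Data_fineSelmerDual_embedding_countRankFree.exists_count_of_finite_coinvariants
    (h : exists_iwasawaH2Data_fineSelmerDual_embedding_countRankFree) (hγ : κ.IsTopGenerator γ)
    (v : HeightOneSpectrum (𝓞 ℚ)) (hp : p ≠ 2) (hκ : κ.IsCyclotomic)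
    (hv : ((Rat.HeightOneSpectrum.primesEquiv v : Nat.Primes) : ℕ) = p)
    (hfin : Finite (FixedPoints.addSubgroup ↥(κ.kerSubgroup ⊓ GreenbergSelmer.decomp v)
      (W.geomPrimaryTorsion p)))
    (I : IwasawaH1Data W p κ γ) :
    ∃ (J : IwasawaH2Data W p κ γ I) (e : (W.fineSelmerDualData κ hγ).X →ₗ[IwasawaAlgebra p] J.H2),
      Function.Injective e ∧ Finite (J.H2 ⧸ LinearMap.range e) ∧
        (Finite (coinvariants p J.H2) →
          Finite (katoStrictSelmer W p {primePlace p}) ∧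
          Nat.card (coinvariants p J.H2) * Nat.card (AddCommGroup.primaryComponent W.toAffine.Point p) =
            Nat.card (katoStrictSelmer W p {primePlace p}) *
              Nat.card (AddCommGroup.primaryComponent
                (W.baseChange ((primePlace p).adicCompletion ℚ)).toAffine.Point p)) := by
  obtain ⟨J, e, he, hcok, hiff, hc⟩ := h W p κ γ hγ v hp hκ hv hfin I
  refine ⟨J, e, he, hcok, fun hJ ↦ ?_⟩
  have hS : Finite (katoStrictSelmer W p {primePlace p}) := hiff.mpr hJ
  exact ⟨hS, (katoH2CountAt_iff W p _).mp (hc hS)⟩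

/-- **H2Xʳ ⟹ the UNGUARDED `Nat.card` identity** (the first typing of this fact, kept as a corollary so that its
consumers are served too): for THE `J ⊇ X₀`, `#(J.H2)_Γ · #W(ℚ)[p^∞] = #Sel_str · #W(ℚ_p)[p^∞]` as `Nat.card`s in every
case — if `Sel_str` is finite this is clause (ii); if not, `(J.H2)_Γ` is infinite by clause (i) and both sides are `0`.
[cite: Kato2004Asterisque, (14.9.3) (p. 240), (14.14.2) (p. 243)] -/
theorem exists_iwasawaH2Data_fineSelmerDual_embedding_countRankFree.exists_natCard_eq
    (h : exists_iwasawaH2Data_fineSelmerDual_embedding_countRankFree) (hγ : κ.IsTopGenerator γ)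
    (v : HeightOneSpectrum (𝓞 ℚ)) (hp : p ≠ 2) (hκ : κ.IsCyclotomic)
    (hv : ((Rat.HeightOneSpectrum.primesEquiv v : Nat.Primes) : ℕ) = p)
    (hfin : Finite (FixedPoints.addSubgroup ↥(κ.kerSubgroup ⊓ GreenbergSelmer.decomp v)
      (W.geomPrimaryTorsion p)))
    (I : IwasawaH1Data W p κ γ) :
    ∃ (J : IwasawaH2Data W p κ γ I) (e : (W.fineSelmerDualData κ hγ).X →ₗ[IwasawaAlgebra p] J.H2),
      Function.Injective e ∧ Finite (J.H2 ⧸ LinearMap.range e) ∧ KatoH2CountAt W p (Nat.card (coinvariants p J.H2)) := by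
  obtain ⟨J, e, he, hcok, hiff, hc⟩ := h W p κ γ hγ v hp hκ hv hfin I
  refine ⟨J, e, he, hcok, ?_⟩
  by_cases hS : Finite (katoStrictSelmer W p {primePlace p})
  · exact hc hS
  · have hJ : ¬ Finite (coinvariants p J.H2) := fun hJ ↦ hS (hiff.mpr hJ)
    haveI : Infinite (katoStrictSelmer W p {primePlace p}) := not_finite_iff_infinite.mp hS
    haveI : Infinite (coinvariants p J.H2) := not_finite_iff_infinite.mp hJ
    rw [katoH2CountAt_iff, Nat.card_eq_zero_of_infinite, Nat.card_eq_zero_of_infinite (α := ↥(katoStrictSelmer W p {primePlace p})),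
      zero_mul, zero_mul]

end Corollaries

end Literature.NumberTheory.EllipticCurves.Kato2004

end
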